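import Summits.ABC.StewartYu.MatveevLeverVolume
import Literature.NumberTheory.Transcendental.PhilipponZeroEstimateMultidegree
import HarnessLib

/-!
# The Matveev–Nesterenko lever: re-indexing the minors sum by `ν`-subsets (`GaGm.absMinor`)

Cell topic `Summits/ABC/StewartYu` (cell abc-stewartyu, seat p4); namespace
`Summit.ABC.StewartYu.MatveevLever` (theorems only). The lever (`exists_short_relation_minors`,
`MatveevLeverVolume.lean`) and Cauchy–Binet index the maximal minors of the `ν × n` basis matrix
by strictly increasing maps `t : Fin ν → Fin n`; the zero estimate's obstruction polynomial
`GaGm.nesterenkoH` (`Literature.NumberTheory.Transcendental.Nesterenko2003_prop51`, Nesterenko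
2003 (5.7)) indexes them by `ν`-subsets `I` through `GaGm.absMinor M I = |det M_I|`. This file is
the dictionary between the two (the bijection `t ↦ image t`, `I ↦ I.orderEmbOfFin`):

* `sum_strictMono_eq_sum_powersetCard` — `∑_{t strictly increasing} F t = ∑_{|I| = ν} F(I.orderEmbOfFin)`;
* `sum_minors_eq_sum_absMinor` —
  `∑_t |det (Mᵢ,t(k))| ∏_k A_{t k} = ∑_{|I| = ν} absMinor M I · ∏_{i ∈ I} Aᵢ`;
* `exists_short_relation_absMinor` — the lever with the minors sum in `absMinor` form, i.e.
  `∏ᵢ ‖zᵢ‖_A ≤ 2^ν (Γ(ν/2+1)/√π^ν) √n^ν ∑_{|I|=ν} |det M_I| ∏_{i∈I} Aᵢ`, which is Nesterenko's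
  (2.13)+(5.21) with `V(Ψ) ≤ ∑_I |det M_I| A_I` literally.

WHAT THIS IS NOT: no conversion `A_I ↔ ∏_{j ∉ I} Dⱼ` (that uses the record's `L/Aⱼ ≤ c Dⱼ`).

## References

* [Nesterenko2003] Yu. V. Nesterenko, *Linear forms in logarithms of rational numbers*, LNM 1819
  (2003), 53–106: (5.7) and §5.2 (5.21), pp. 97, 103.
-/

noncomputable section

namespace Summit.ABC.StewartYu.MatveevLever

open Matrix Finset
open Literature.NumberTheory.Transcendental.GaGm

open scoped Classical in
/-- **Strictly increasing maps `Fin ν → Fin n` ↔ `ν`-subsets.**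
`∑_{t strictly increasing} F t = ∑_{|I| = ν} F (I.orderEmbOfFin)`. [folklore] -/
theorem sum_strictMono_eq_sum_powersetCard {ν n : ℕ} {β : Type*} [AddCommMonoid β]
    (F : (Fin ν → Fin n) → β) :
    ∑ t ∈ (univ : Finset (Fin ν → Fin n)).filter (fun t => StrictMono t), F t =
      ∑ I ∈ (univ : Finset (Fin n)).powersetCard ν,
        if h : I.card = ν then F (fun k => I.orderEmbOfFin h k) else 0 := by
  refine Finset.sum_bij' (fun t _ => univ.image t)
    (fun I hI => fun k => I.orderEmbOfFin (Finset.mem_powersetCard.mp hI).2 k) ?_ ?_ ?_ ?_ ?_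
  · intro t ht
    rw [Finset.mem_filter] at ht
    rw [Finset.mem_powersetCard]
    exact ⟨Finset.subset_univ _, by
      rw [Finset.card_image_of_injective _ ht.2.injective, Finset.card_univ, Fintype.card_fin]⟩
  · intro I hI
    rw [Finset.mem_filter]
    exact ⟨Finset.mem_univ _, (I.orderEmbOfFin _).strictMono⟩
  · intro t ht
    rw [Finset.mem_filter] at ht
    have hcard : (univ.image t).card = ν := by
      rw [Finset.card_image_of_injective _ ht.2.injective, Finset.card_univ, Fintype.card_fin]
    have hu := Finset.orderEmbOfFin_unique hcard (f := t)
      (fun x => Finset.mem_image_of_mem t (Finset.mem_univ x)) ht.2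
    funext k
    exact (congrFun hu k).symm
  · intro I hI
    exact Finset.image_orderEmbOfFin_univ I (Finset.mem_powersetCard.mp hI).2
  · intro t ht
    rw [Finset.mem_filter] at ht
    have hcard : (univ.image t).card = ν := by
      rw [Finset.card_image_of_injective _ ht.2.injective, Finset.card_univ, Fintype.card_fin]
    rw [dif_pos hcard]
    have hu := Finset.orderEmbOfFin_unique hcard (f := t)
      (fun x => Finset.mem_image_of_mem t (Finset.mem_univ x)) ht.2
    congr 1

open scoped Classical in
/-- **The minors sum in `absMinor` form**: for an integer `ν × n` matrix `M` and weights `A`,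
`∑_{t strictly increasing} |det (Mᵢ,t(k))| · ∏_k A_{t k} = ∑_{|I| = ν} absMinor M I · ∏_{i ∈ I} Aᵢ`
(`GaGm.absMinor M I = |det M_I|`, columns in increasing order). [cite: Nesterenko2003, §5.1 (5.7), p. 97] -/
theorem sum_minors_eq_sum_absMinor {ν n : ℕ} (M : Matrix (Fin ν) (Fin n) ℤ) (A : Fin n → ℝ) :
    ∑ t ∈ (univ : Finset (Fin ν → Fin n)).filter (fun t => StrictMono t),
        |(Matrix.of fun i k => (M i (t k) : ℝ)).det| * ∏ k, A (t k) =
      ∑ I ∈ (univ : Finset (Fin n)).powersetCard ν, (absMinor M I : ℝ) * ∏ i ∈ I, A i := by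
  rw [sum_strictMono_eq_sum_powersetCard]
  refine Finset.sum_congr rfl fun I hI => ?_
  have hcard : I.card = ν := (Finset.mem_powersetCard.mp hI).2
  rw [dif_pos hcard]
  have hdet : (Matrix.of fun i k => (M i (I.orderEmbOfFin hcard k) : ℝ)).det =
      ((M.submatrix id (fun k => I.orderEmbOfFin hcard k)).det : ℝ) := by
    have h1 : (Matrix.of fun i k => (M i (I.orderEmbOfFin hcard k) : ℝ)) =
        (M.submatrix id (fun k => I.orderEmbOfFin hcard k)).map (Int.castRingHom ℝ) := by
      ext i k; simp
    rw [h1, det_map_castRingHom]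
  have habs : |(Matrix.of fun i k => (M i (I.orderEmbOfFin hcard k) : ℝ)).det| = (absMinor M I : ℝ) := by
    rw [hdet, absMinor, dif_pos hcard, Nat.cast_natAbs, Int.cast_abs]
  have hprod : ∏ k, A (I.orderEmbOfFin hcard k) = ∏ i ∈ I, A i := by
    rw [← Finset.prod_image (s := univ) (g := fun k => I.orderEmbOfFin hcard k) (f := A)
      (fun x _ y _ h => (I.orderEmbOfFin hcard).injective h)]
    rw [Finset.image_orderEmbOfFin_univ]
  rw [habs, hprod]

open scoped Classical in
/-- **The lever against `∑_{|I|=ν} |det M_I| ∏_{i∈I} Aᵢ`** (Nesterenko 2003, Prop. 2.6 data with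
(5.19)–(5.21), minors sum indexed as in `GaGm.nesterenkoH`): for weights `Aⱼ > 0`, a
`ℤ`-independent basis `a` of `Φ` and `k b ∈ Φ` (`k ≠ 0`) there are `ℤ`-independent
`z₁, …, z_ν ∈ Φ`, `m₀ ≠ 0`, `m`, `J` with `m₀ b = ∑ mᵢ zᵢ`,
`∏ᵢ ‖zᵢ‖_A ≤ 2^ν (Γ(ν/2+1)/√π^ν) √n^ν ∑_{|I|=ν} absMinor a I ∏_{i∈I} Aᵢ`, (2.11) and (2.12).
[cite: Nesterenko2003, Prop 2.6 (2.9)–(2.13) and §5.2 (5.21), pp. 57–58, 103] -/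
theorem exists_short_relation_absMinor {n ν : ℕ} (hν : 0 < ν) (A : Fin n → ℝ) (hA : ∀ j, 0 < A j)
    (a : Fin ν → (Fin n → ℤ)) (ha : LinearIndependent ℤ a)
    (b : Fin n → ℤ) (k : ℤ) (hk : k ≠ 0) (c : Fin ν → ℤ) (hb : k • b = ∑ i, c i • a i) :
    ∃ (z : Fin ν → (Fin n → ℤ)) (m₀ : ℤ) (m : Fin ν → ℤ) (J : Finset (Fin n)),
      (∀ i, z i ∈ Submodule.span ℤ (Set.range a)) ∧
      LinearIndependent ℤ z ∧
      m₀ ≠ 0 ∧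
      m₀ • b = ∑ i, m i • z i ∧
      J.card = ν ∧
      (∏ i, ∑ j, A j * |(z i j : ℝ)|) ≤
        2 ^ ν * (Real.Gamma ((ν : ℝ) / 2 + 1) / Real.sqrt Real.pi ^ ν) *
          (Real.sqrt n ^ ν *
            ∑ I ∈ (univ : Finset (Fin n)).powersetCard ν,
              (absMinor (Matrix.of a) I : ℝ) * ∏ i ∈ I, A i) ∧
      |(m₀ : ℝ)| * ∏ j ∈ J, A j ≤ ∏ i, ∑ j, A j * |(z i j : ℝ)| ∧
      ∀ i, |(m i : ℝ)| * ∏ j ∈ J, A j ≤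
        (∑ j ∈ J, |(b j : ℝ)| * A j) * ∏ i' ∈ univ.erase i, ∑ j, A j * |(z i' j : ℝ)| := by
  obtain ⟨z, m₀, m, J, h1, h2, h3, h4, h5, h6, h7, h8⟩ :=
    exists_short_relation_minors hν A hA a ha b k hk c hb
  refine ⟨z, m₀, m, J, h1, h2, h3, h4, h5, ?_, h7, h8⟩
  rw [← sum_minors_eq_sum_absMinor (Matrix.of a) A]
  simpa only [Matrix.of_apply] using h6

end Summit.ABC.StewartYu.MatveevLever

end
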